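import Literature.AlgebraicGeometry.Motives.FaltingsECSubspacesHom
import Literature.NumberTheory.EllipticCurves.IsogenyDualProofs
import HarnessLib

/-!
# Faltings' Korollar 1 for `(E, E')`: the reduction to two named facts

D-0014 keeps `Literature/` sorry-free by stating cited results as named facts `def X : Prop`.
This sibling of `Literature.AlgebraicGeometry.Motives.FaltingsECSubspacesHom` concerns the named
fact `Literature.Hodge.mem_span_range_tateModule_map_of_equivariant W W' ℓ`
(`Literature.AlgebraicGeometry.Motives.FaltingsEC`) — the elliptic-curve case of G. Faltings,
*Endlichkeitssätze für abelsche Varietäten über Zahlkörpern*, Invent. Math. 73 (1983), §5,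
Satz 4 with Korollar 1: for elliptic curves `E, E'` over a number field `K` and a prime `ℓ`, every
`Γ_K`-equivariant `ℤ_ℓ`-linear map `T_ℓ E → T_ℓ E'` is a `ℤ_ℓ`-linear combination of the maps
`T_ℓ φ`, `φ : E → E'` an isogeny defined over `K` (surjectivity of
`Hom_K(E, E') ⊗ ℤ_ℓ → Hom_{Γ_K}(T_ℓ E, T_ℓ E')`).

`FaltingsECSubspacesHom` derives this fact (`mem_span_range_tateModule_map_of_equivariant_of_pair_facts`)
from four named facts of the tree: the deep one, `Literature.Hodge.stable_subspace_prod_eq_range_pair W W' ℓ`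
(Faltings' subspace assertion for the abelian surface `A = E × E'`, i.e. "Theorem 4 applied to
`A₁ × A₂`"), and three results of the elementary theory of isogenies —
`WeierstrassCurve.geomEndRing_comm` (*AEC* III.9.4: `End(E)` is commutative in characteristic
`0`), `WeierstrassCurve.Isogeny.exists_dual` for `(E', E)` (*AEC* III.6.1: the dual isogeny) and
`WeierstrassCurve.Isogeny.exists_eq_comp_nsmul_of_geomTorsion_le_ker W W'` (*AEC* III.4.11:
isogenies killing `E[m]` factor through `[m]`). Two of the three have since been **proved** in the
tree:

* *AEC* III.4.11 is `WeierstrassCurve.Isogeny.exists_eq_comp_nsmul_of_geomTorsion_le_ker_holds`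
  (`Literature.NumberTheory.EllipticCurves.IsogenyFactorProofs`);
* the dual isogeny in characteristic `0`, for elliptic `W, W'`, is
  `WeierstrassCurve.Isogeny.exists_dual_of_isElliptic`
  (`Literature.NumberTheory.EllipticCurves.IsogenyDualProofs`); a number field has
  characteristic `0` (`NumberField.to_charZero`), and the instances `[W.IsElliptic]`,
  `[W'.IsElliptic]` are available at the point of use because the fact quantifies them in its
  body.

This file feeds both in. What remains is the reduction of Korollar 1 for `(E, E')` — and with it
of Korollar 2, Faltings' isogeny criterion `isIsogenous_iff_exists_tateModule_hom_ne_zero W W' ℓ` —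
to exactly **two** named facts: Faltings' subspace assertion for `E × E'` and the commutativity
of `End(E)` in characteristic `0`.

## Contents (all proved)

* `Literature.AlgebraicGeometry.Motives.exists_dual_weak_of_numberField`: over a number field, every isogeny `ψ : E' → E`
  of elliptic curves has a "weak dual" `φ : E → E'` with `φ ∘ ψ = [n]`, `n ≠ 0` (here
  `n = deg ψ`), the form in which `FaltingsECSubspacesHomProofs` consumes *AEC* III.6.1.
* `Literature.AlgebraicGeometry.Motives.mem_rationalHomSpan_of_equivariant_of_pair_facts'`: the `ℚ_ℓ`-form of Korollar 1
  (`Hom_K(E, E') ⊗ ℚ_ℓ → Hom_{Γ_K}(V_ℓ E, V_ℓ E')` is onto) from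
  `stable_subspace_prod_eq_range_pair W W' ℓ` and `W.geomEndRing_comm`.
* `Literature.AlgebraicGeometry.Motives.mem_span_range_tateModule_map_of_equivariant_of_pair_facts'`: the named fact
  `mem_span_range_tateModule_map_of_equivariant W W' ℓ` from the same two.
* `Literature.AlgebraicGeometry.Motives.isIsogenous_iff_exists_tateModule_hom_ne_zero_of_pair_facts'`: the named fact
  `isIsogenous_iff_exists_tateModule_hom_ne_zero W W' ℓ` (Korollar 2, (i) ⇔ (ii)) from the same
  two.

The primed names follow `mem_span_range_tateEndRingHom_iff_of_facts'` of
`Literature.AlgebraicGeometry.Motives.FaltingsECSubspaces`, the analogous two-fact form of Satz 4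
for a single curve.

## What is *not* proved

Neither remaining input. `stable_subspace_prod_eq_range_pair W W' ℓ` is Faltings' theorem for the
abelian surface `E × E'` (Satz 1: finiteness for bounded modular height; Satz 2: invariance of the
height along an `ℓ`-divisible group, via Tate–Raynaud and the Hodge–Tate decomposition; Tate's
lattice argument and Zarhin's trick), whose quotients `(E × E')/G_n` are abelian surfaces that are
not products of elliptic curves; it has no formulation in terms of `E, E'` alone (see the module
docstring of `FaltingsECSubspacesHom`, and `Literature.AlgebraicGeometry.Motives.FaltingsAbelian`
with `Literature.AlgebraicGeometry.Motives.FaltingsECOfAbelianVarietyProofs` for the alternative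
reduction to hodge.S27 at the level of abelian varieties plus bridge data).
`WeierstrassCurve.geomEndRing_comm` (*AEC* III.9.4 with III.5: in characteristic `0` the
invariant differential embeds `End(E)` into `K̄`) needs differentials or formal groups of
elliptic curves, which the preludes do not have. The commutativity hypothesis cannot simply be
dropped from the graph argument (`Literature.AlgebraicGeometry.Motives.mem_of_graph_eq_range`): in the algebra `E` of upper
triangular `2 × 2` matrices, `a = E₁₂`, `b = E₂₂`, `α = E₂₁` satisfy `α a = E₂₂ ∈ E`,
`α b = 0 ∈ E`, `a V + b V = V`, so the graph of `α` is the image of `(a b; αa αb)` with entries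
in `E`, yet `α ∉ E`.

## References

* [Faltings1983Endlichkeit] G. Faltings, Invent. Math. 73 (1983), 349–366, §5: Satz 4,
  Korollar 1 ("Theorem 4 applied to `A₁ × A₂`"), Korollar 2; English translation
  [Faltings1986FinitenessTranslation], Cornell–Silverman (eds.), *Arithmetic Geometry* (1986),
  Ch. II, §5, Theorem 4, Corollaries 1–2.
* [SilvermanAEC2009] J. H. Silverman, *The Arithmetic of Elliptic Curves*, 2nd ed., GTM 106:
  Cor. III.4.11, Thm. III.6.1(a), Thm. III.7.4, Thm. III.7.7, Cor. III.9.4.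

## Design choices

* `noncomputable section`, `namespace Literature.Hodge`, `K : Type u`, exactly as in
  `FaltingsECSubspacesHom`; no definitions, proofs only.
* The instance arguments of the consumed theorems are those of the ambient binders
  `[NumberField K] [W.IsElliptic] [W'.IsElliptic]` introduced from the bodies of the facts;
  `CharZero K` is found through `NumberField.to_charZero`.
-/

noncomputable section

universe u

namespace Literature.AlgebraicGeometry.Motives

open WeierstrassCurve

variable {K : Type u} [Field K] (W W' : WeierstrassCurve K) (ℓ : ℕ) [Fact ℓ.Prime]

/-- **Weak dual isogeny over a number field** (the dual isogeny, *AEC* III.6.1(a), in the form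
consumed by the graph argument for a pair): for elliptic curves `E, E'` over a number field `K`
and an isogeny `ψ : E' → E` over `K` there are an isogeny `φ : E → E'` over `K` and `n ≠ 0` with
`φ (ψ Q) = n • Q` for all `Q ∈ E'(K̄)`; namely `φ = ψ̂`, `n = deg ψ = #ker ψ`
(`Isogeny.exists_dual_of_isElliptic`, characteristic `0`). [cite: SilvermanAEC2009, Thm. III.6.1(a)] -/
theorem exists_dual_weak_of_numberField [NumberField K] [W.IsElliptic] [W'.IsElliptic]
    (ψ : Isogeny W' W) :
    ∃ (φ : Isogeny W W') (n : ℕ), n ≠ 0 ∧ ∀ Q, φ (ψ Q) = (n : ℤ) • Q := by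
  obtain ⟨φ, hφ⟩ := ψ.exists_dual_of_isElliptic
  exact ⟨φ, ψ.degree, ψ.degree_pos.ne', hφ⟩

variable {W W'} in
/-- **The `ℚ_ℓ`-form of Faltings' Korollar 1 for `(E, E')` from two named facts.** For elliptic
curves `E, E'` over a number field `K` and a prime `ℓ`, granted
`stable_subspace_prod_eq_range_pair W W' ℓ` (Faltings 1983, §5, Sätze 3–4 for `A = E × E'`) and
`WeierstrassCurve.geomEndRing_comm` for `E` (*AEC* III.9.4), every `Γ_K`-equivariant
`ℚ_ℓ`-linear map `V_ℓ E → V_ℓ E'` lies in `H_ℓ(E, E')`, the image of `Hom_K(E, E') ⊗ ℚ_ℓ`: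
`mem_span_baseChange_tateModule_map_of_subspaces_pair` (`FaltingsECSubspacesHomProofs`) with the
dual isogeny supplied by `exists_dual_weak_of_numberField`.
[cite: Faltings1983Endlichkeit, §5, Satz 4, Korollar 1] -/
theorem mem_rationalHomSpan_of_equivariant_of_pair_facts'
    (hX : stable_subspace_prod_eq_range_pair W W' ℓ) (hcomm : W.geomEndRing_comm) [NumberField K]
    [W.IsElliptic] [W'.IsElliptic] {G : W.rationalTateModule ℓ →ₗ[ℚ_[ℓ]] W'.rationalTateModule ℓ}
    (hG : ∀ (σ : Field.absoluteGaloisGroup K) (v : W.rationalTateModule ℓ),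
      G (rationalGaloisRepTate W ℓ σ v) = rationalGaloisRepTate W' ℓ σ (G v)) :
    G ∈ rationalHomSpan W W' ℓ :=
  mem_span_baseChange_tateModule_map_of_subspaces_pair W W' ℓ (fun U hU ↦ hX U hU) hcomm
    (exists_dual_weak_of_numberField W W') G hG

/-- **Faltings' Korollar 1 for `(E, E')` from two named facts.** For Weierstrass curves `W, W'`
over `K` and a prime `ℓ`, the named fact `mem_span_range_tateModule_map_of_equivariant W W' ℓ`
(for `E, E'` elliptic over a number field, `Hom_K(E, E') ⊗ ℤ_ℓ → Hom_{Γ_K}(T_ℓ E, T_ℓ E')` is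
onto: Faltings 1983, §5, Satz 4, Korollar 1) follows from
`stable_subspace_prod_eq_range_pair W W' ℓ` (Faltings' subspace assertion for the abelian surface
`E × E'`, the one deep input) and `WeierstrassCurve.geomEndRing_comm` for `E` (*AEC* III.9.4).
This is `mem_span_range_tateModule_map_of_equivariant_of_rational` (`FaltingsECSubspacesHomProofs`:
clearing denominators and saturation of `ℤ_ℓ · {T_ℓ φ}`) over the `ℚ_ℓ`-form
`mem_rationalHomSpan_of_equivariant_of_pair_facts'`, with *AEC* III.4.11 supplied by its discharge
`Isogeny.exists_eq_comp_nsmul_of_geomTorsion_le_ker_holds W W'` and *AEC* III.6.1 by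
`Isogeny.exists_dual_of_isElliptic`. Compared with
`mem_span_range_tateModule_map_of_equivariant_of_pair_facts` (`FaltingsECSubspacesHom`), the
hypotheses `hdual` and `h411` are gone.
[cite: Faltings1983Endlichkeit, §5, Satz 4, Korollar 1 ("Theorem 4 applied to A₁ × A₂")] -/
theorem mem_span_range_tateModule_map_of_equivariant_of_pair_facts'
    (hX : stable_subspace_prod_eq_range_pair W W' ℓ) (hcomm : W.geomEndRing_comm) :
    mem_span_range_tateModule_map_of_equivariant W W' ℓ :=
  mem_span_range_tateModule_map_of_equivariant_of_rational W W' ℓ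
    (fun _ hG ↦ mem_rationalHomSpan_of_equivariant_of_pair_facts' ℓ hX hcomm hG)
    (Isogeny.exists_eq_comp_nsmul_of_geomTorsion_le_ker_holds W W')

/-- **Faltings' Korollar 2 for `(E, E')` from two named facts**: the named fact
`isIsogenous_iff_exists_tateModule_hom_ne_zero W W' ℓ` (elliptic curves over a number field are
isogenous over `K` iff they admit a non-zero `Γ_K`-equivariant `ℤ_ℓ`-linear map `T_ℓ E → T_ℓ E'`;
Faltings 1983, §5, Korollar 2, (i) ⇔ (ii)) follows from
`stable_subspace_prod_eq_range_pair W W' ℓ` and `WeierstrassCurve.geomEndRing_comm` for `E`,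
through Korollar 1 (`mem_span_range_tateModule_map_of_equivariant_of_pair_facts'`) and the tree's
`isIsogenous_iff_exists_tateModule_hom_ne_zero_of_satz4` (`FaltingsECIsogenyProofs`).
[cite: Faltings1983Endlichkeit, §5, Satz 4, Korollar 1, Korollar 2 (i)⇔(ii)] -/
theorem isIsogenous_iff_exists_tateModule_hom_ne_zero_of_pair_facts'
    (hX : stable_subspace_prod_eq_range_pair W W' ℓ) (hcomm : W.geomEndRing_comm) :
    isIsogenous_iff_exists_tateModule_hom_ne_zero W W' ℓ :=
  isIsogenous_iff_exists_tateModule_hom_ne_zero_of_satz4 W W' ℓ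
    (mem_span_range_tateModule_map_of_equivariant_of_pair_facts' W W' ℓ hX hcomm)

end Literature.AlgebraicGeometry.Motives
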